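import Mathlib.Analysis.SpecialFunctions.ContinuousFunctionalCalculus.ExpLog.Order
import Mathlib.Analysis.CStarAlgebra.Matrix
import Mathlib.Analysis.Matrix.Order
import HarnessLib

/-!
# The matrix logarithm is Löwner-monotone on positive definite matrices

For positive definite complex matrices, `A ≤ B` in the Löwner order implies `log A ≤ log B`
[cite: Bernstein2009, Prop. 8.6.13 xviii) and its proof, p. 464] ('φ(A) ≜ log A is increasing on
Pⁿ'; the classical operator-monotonicity of the logarithm, Löwner 1934). Here `log` is the
continuous-functional-calculus logarithm `CFC.log A = cfc Real.log A` of Mathlib, i.e. the spectral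
logarithm of a Hermitian matrix, and the order is Mathlib's Löwner order on matrices
(`open scoped MatrixOrder`: `A ≤ B ↔ (B - A).PosSemidef`).

The proof is Mathlib's abstract C⋆-algebra statement `CFC.log_le_log`, instantiated on
`Matrix n n ℂ` with the `L²`-operator norm (`open scoped Matrix.Norms.L2Operator`; the C⋆-algebra
structure is assembled from Mathlib's scoped instances exactly as in
`Literature/MathematicalPhysics/QuantumFieldTheory/Balaban1983to89/BlockAveragingExpMeanLog.lean`).
Consumers: the entropy (weak-monotonicity) tangent cuts of `Summits/Ventures/CertifiedManyBodySolver`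
(lever family `ent`, op-08 `entropy-cuts.md` §4: `exp Ỹ ⪰ Tr₁ exp X̃ ⇒ Ỹ ⪰ log Tr₁ exp X̃`).
-/

namespace Literature.LinearAlgebra.Matrix

open scoped MatrixOrder ComplexOrder Matrix.Norms.L2Operator

variable {n : Type*} [Fintype n] [DecidableEq n]

/-- **The logarithm is matrix monotone** (Löwner order form): for positive definite `A` and
`A ≤ B`, `log A ≤ log B` [cite: Bernstein2009, Prop. 8.6.13 xviii), p. 464]. -/
theorem log_le_log_of_posDef {A B : Matrix n n ℂ} (hA : A.PosDef) (hAB : A ≤ B) :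
    CFC.log A ≤ CFC.log B := by
  letI : CStarAlgebra (Matrix n n ℂ) := {}
  exact CFC.log_le_log hAB hA.isStrictlyPositive

/-- **The logarithm is matrix monotone** (`PosSemidef` form): for positive definite `A` with
`B - A` positive semidefinite, `log B - log A` is positive semidefinite
[cite: Bernstein2009, Prop. 8.6.13 xviii), p. 464]. -/
theorem posSemidef_log_sub_log {A B : Matrix n n ℂ} (hA : A.PosDef) (hAB : (B - A).PosSemidef) :
    (CFC.log B - CFC.log A).PosSemidef :=
  Matrix.le_iff.mp (log_le_log_of_posDef hA (Matrix.le_iff.mpr hAB))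

/-- The `cfc Real.log` spelling of `posSemidef_log_sub_log` (Mathlib's `CFC.log a` is by definition
`cfc Real.log a`) [cite: Bernstein2009, Prop. 8.6.13 xviii), p. 464]. -/
theorem posSemidef_cfc_log_sub_cfc_log {A B : Matrix n n ℂ} (hA : A.PosDef)
    (hAB : (B - A).PosSemidef) : (cfc Real.log B - cfc Real.log A).PosSemidef :=
  posSemidef_log_sub_log hA hAB

end Literature.LinearAlgebra.Matrix
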